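import Literature.MathematicalPhysics.QuantumFieldTheory.Dimock2011to13.TreeGraphSummation
import Literature.MathematicalPhysics.QuantumFieldTheory.Dimock2011to13.SteinerLengthSums
import Literature.MathematicalPhysics.QuantumFieldTheory.Dimock2011to13.SteinerLengthUnionBound

/-!
# Dimock, *The renormalization group according to Balaban* I, Appendix B, proof of THEOREM `\label{cluster}`, STEP 4
# ON THE CELL'S `ℤ^d` CARRIER — the `n`-th term bound of (hstar) and its summed form with the hypotheses (sudsy),
# (ninety) DISCHARGED by Appendix E (Lemma E.2 for the Steiner length), and (v1.1) the DECAY EXTRACTION by (clams):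
# the `n`-th term over the tuples covering `Y` decays like `e^{−(κ−2κ₀)ℓ̃(Y)}`, the series like
# `e^{−(κ−2κ₀−1)ℓ̃(Y)}` — PROVED

**Citation header (reproduction of PUBLISHED work; template of the Bałaban lattice Yang–Mills cell).**
J. Dimock, *The renormalization group according to Balaban I. Small fields*, Rev. Math. Phys. **25** (2013) 1330010
(= arXiv:1108.1335v2) [Dimock2013]: eq. (ninety) TeX L1344–1348, App. A = `\section{estimates}` Cor.
`\label{cranberry}` = (sudsy) L3140–3156, App. B step 1 eq. (clams) L3246–3256, step 4 L3405–3511.  The inputs come from the sibling leaves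
`TreeGraphSummation` (step 4's tuple summation, abstract; v1.1 §5: the hypotheses from an anchored exponential
norm) and `SteinerLengthSums` ([Dimock2013BalabanII] App. E, Lemma E.2 for the cell's Steiner length `ℓ̃` =
`Balaban1983to89.TreeLength.steinerLen`, pv22).  TeX line numbers refer to the arXiv source held by the cell
(`inputs/files/dimock/src/1108.1335/1108.1335.tex`).  Dimock's papers are published and refereed and are the
cell's TEMPLATE, not manuscripts under audit; no quantity of the Bałaban series is touched.

**What the paper prints (verbatim).**  (ninety), L1343–1348: *"Then we have the inequalities [Bal98b] d_M(X) ≤ |X|_M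
≤ 3^d(1 + d_M(X)) here with d=3."*  (sudsy), L3140–3147: *"Σ_{X: X ∩ Y ≠ ∅} e^{−a|X|_M} ≤ b|Y|_M  Σ_{X: X ∩ Y ≠ ∅}
e^{−κ₀d_M(X)} ≤ K₀|Y|_M"*.  Step 4, L3452–3468: *"For the sum over Y_n we we have by (sudsy) Σ_{Y_n ∩ Y_{τ(n)} ≠ ∅}
e^{−2κ₀d_M(Y_n)} ≤ K₀|Y_{τ(n)}|_M … ≤ (d_j−1)! K₀e^{κ₀}|Y_{τ(j)}| Here we used again |Y_j|_M ≤ κ₀(1 + d_M(Y_j))"*;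
L3504–3509: *"divide by n! and sum over n … ≤ O(1)H₀e^{−(κ₂−2κ₀−1)d_M(Y)} provided H₀ ≤ c₀ and c₀ is sufficiently
small."*

**What is reproduced here (kernel-checked, zero `sorry`).**  Step 4's bound INSTANTIATED on the carrier of the cell
— polymers = non-empty finite sets of unit cubes `X ⊂ ℤ^d` (`Finset (Pt d)`), `d_M :=` the Steiner length `ℓ̃`
(`steinerLen`, the length of a shortest connected polygonal graph meeting every cube), `|X|_M := #X` — with the two
model inequalities that `TreeGraphSummation` takes as hypotheses now THEOREMS of the tree:
* `exp_card_le`, `weight_mul_exp_card_le` — (ninety)'s role (*"|Y_j|_M ≤ κ₀(1 + d_M(Y_j))"*) is played by the cell's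
  `TreeLength.card_le_steinerLen` (`#X ≤ 2^d(4ℓ̃(X) + 1)`, pv22's form of Lemma E.1 (3)): `e^{#X} ≤ e^{2^d}
  e^{2^{d+2}ℓ̃(X)}`, so `e^{−2κ₀ℓ̃(X)}e^{#X} ≤ e^{2^d}e^{−(2κ₀−2^{d+2})ℓ̃(X)}`.
* `phi d κ₀` — the explicit constant `φ = e^{2^d}·2·exp((2κ₀ − 2^{d+2})(2^d − 1)/(2 + 2^{d+2}))` standing in for
  Dimock's `K₀e^{κ₀}`; **`anchoredNorm_le`** — (sudsy)'s role is played by App. E's `SteinerLengthSums.kumquat_steiner`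
  (`Σ_{X ∋ q} e^{−aℓ̃(X)} ≤ 2e^{a(2^d−1)/(2+2^{d+2})}` once `3^d e^{−a/(2+2^{d+2})} ≤ 1/8`), at `a = 2κ₀ − 2^{d+2}`: for
  weights `0 ≤ w(X) ≤ H·e^{−2κ₀ℓ̃(X)}` the ANCHORED EXPONENTIAL NORM `Σ_{X∈Q: q∈X} w(X)e^{#X} ≤ H·φ` for every cube `q`.
* **`sum_abs_rhoT_mul_prod_le`** — `Σ_{(Y_j)∈Q^n} |ρ^T(Y_1,…,Y_n)|·Π_j w(Y_j) ≤ (Hφ)^n·#Y·(n−1)!·4^{n−1}` for every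
  finite set `Q` of non-empty cube polymers all meeting `Y`, `n ≥ 1` (`TreeGraphSummation.sum_abs_rhoT_mul_prod_le_of_anchored`);
  **`hstar_partialSum_le_lattice`** — for `Hφ ≤ 1/8` (*"provided H₀ ≤ c₀"*) every partial sum of `Σ_n (1/n!)·(n-th
  term)` is `≤ 2·Hφ·#Y` (`TreeGraphSummation.hstar_partialSum_le`).
* §2 (v1.1) THE DECAY EXTRACTION (L3430–3438: *"Next use the inequality (clams) to bound this by e^{−(κ₂−2κ₀)d_M(Y)}
  (O(1)H₀)^n Σ_τ Σ Π_i e^{−2κ₀d_M(Y_i)}"*): **`steinerLen_biUnion_le_of_tree`** — (clams) along a tree graph (`ℓ̃(⋃_u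
  Z_u) ≤ Σ_u ℓ̃(Z_u) + (n−1)` for a tuple compatible with a tree graph; the sibling `SteinerLengthUnionBound`'s ordered
  (clams) after `TreeGraphSummation.exists_relabel`), `prod_exp_neg_le_of_tree` (`Π_u e^{−κ′ℓ̃(Z_u)} ≤ e^{κ′(n−1)}
  e^{−κ′ℓ̃(⋃Z)}`), `exists_tree_of_rhoT_ne_zero` (a tuple with `ρ^T ≠ 0` carries a tree graph —
  `abs_rhoT_le_card_treeGraphs`), **`sum_abs_rhoT_mul_prod_le_decay`** — for weights `0 ≤ w ≤ He^{−κℓ̃}`, `κ ≥ 2κ₀`: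
  `Σ_{Z∈Q^n, ⋃Z=Y} |ρ^T(Z)|·Π_j w(Z_j) ≤ e^{(κ−2κ₀)(n−1)}·e^{−(κ−2κ₀)ℓ̃(Y)}·(Hφ)^n·#Y·(n−1)!·4^{n−1}`,
  `card_le_exp_steinerLen` (`#Y ≤ 2^{d+2}e^{ℓ̃(Y)}`, the root's volume folded into the decay, L3476–3477), and
  **`hstar_partialSum_le_decay`** — for `4Hφe^{κ−2κ₀} ≤ 1/2` (*"provided H₀ ≤ c₀ … (So c₀ does depend on κ.)"*) every
  partial sum of `Σ_n (1/n!)·Σ_{⋃Z=Y}|ρ^T|Πw` is `≤ 2·Hφ·#Y·e^{−(κ−2κ₀)ℓ̃(Y)}` — the shape of (sunshine0)'s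
  `O(1)H₀e^{−(κ₂−2κ₀−1)d_M(Y)}` on the carrier (with `#Y ≤ 2^{d+2}e^{ℓ̃(Y)}`).

**Readings (declared).**  (i) `M = 1` (Dimock L3150: *"Again it suffices to take M=1"*); the carrier is `ℤ^d`, not
the torus (App. E's sums are over finite families of finite cube sets — no volume enters).  (ii) `d_M` is read as the
cell's Steiner length `ℓ̃` over connected polygonal graphs (pv22 convention D-pv22.1; `SteinerLengthSums` DEVIATIONS) —
Dimock's *"length of the shortest tree in X joining the M-cubes in X"* (L1325–1327) additionally requires the tree to
lie IN `X`; `ℓ̃ ≤` that length, so weights `e^{−2κ₀ d_M}` in Dimock's sense satisfy the hypothesis `w ≤ He^{−2κ₀ℓ̃}` a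
fortiori.  (iii) The constants are the cell's (`2^d(4ℓ̃+1)` for (ninety), App. E's for (sudsy)), not Dimock's `3^d`,
`κ₀`, `K₀`; the threshold on `κ₀` is explicit.  (iv) `H` is the activity size (Dimock's `O(1)H₀` of (owl) after the
decay extraction) — a free parameter here.

**What is NOT claimed.**  Step 2 and (owl) (the weights `w ≤ He^{−κℓ̃}` are the hypothesis standing for `|K^#(X)| ≤
O(1)H₀e^{−κ₂d_M(X)}`); the torus; the identification with the `M`-polymer vocabulary of `MayerExpansion`∕
`Phi43PolymerRepresentation` (not imported); THEOREM `cluster` ∕ (sunshine0) as printed (constants: the cell's, not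
Dimock's `O(1)`, `c₀`); infinite sums (partial sums bounded); anything of B1–B16 (TEMPLATE.md §4.1 row «D1 §4.6» —
grade there).  NOT summit progress; NOT a statement about any Bałaban paper; NOT continuum; NOT Clay.  Imports the
siblings `…Dimock2011to13.TreeGraphSummation` (v1.1), `…Dimock2011to13.SteinerLengthSums` (which imports
`DisconnectedPolymerSums` and the Bałaban-side pv22 unit `Balaban1983to89.TreeLength` — a geometry unit about polygonal
graphs in `ℝ^d`, no statement of any Bałaban paper) and (v1.1) `…Dimock2011to13.SteinerLengthUnionBound` ((clams) for
`ℓ̃`; imports `TreeLength` only); none imports this file; no cycle; no Summits import; sub-namespace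
`…Dimock2011to13.TreeGraphSummationLattice`; modifies nothing.  Unit `b2b-balaban-template` gen 33 (journal CLAIM
D1-STEP4-LATTICE-KERNEL, round 5 CLAIM D1-CLAMS-KERNEL); cell records TEMPLATE.md §4.1 row «D1 §4.6», §15.2; GAPS
C-tmpl33-6 (v1), C-tmpl33-7 (v1.1).

**Version.**  v1 (unit `b2b-balaban-template` gen 33 round 4, p209890).  v1.1 (same unit and gen, round 5) — ADDITIVE to
v1: + import `…SteinerLengthUnionBound`; + §2 (`steinerLen_biUnion_le_of_tree`, `prod_exp_neg_le_of_tree`,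
`exists_tree_of_rhoT_ne_zero`, `sum_abs_rhoT_mul_prod_le_decay`, `card_le_exp_steinerLen`, `hstar_partialSum_le_decay`);
header title, bullet §2, NOT-claimed list and this line updated; every v1 declaration byte-identical.
-/

noncomputable section

open Finset
open Literature.MathematicalPhysics.QuantumFieldTheory.Balaban1983to89.B13ScaleTransfer (Pt)
open Literature.MathematicalPhysics.QuantumFieldTheory.Balaban1983to89.TreeLength (steinerLen steinerLen_nonneg
  card_le_steinerLen)
open Literature.MathematicalPhysics.QuantumFieldTheory.Dimock2011to13.SteinerLengthSums (kumquat_steiner)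
open Literature.MathematicalPhysics.QuantumFieldTheory.Dimock2011to13.TreeGraphSummation
  (sum_abs_rhoT_mul_prod_le_of_anchored vertexHyp_of_anchored rootHyp_of_anchored hstar_partialSum_le)
open Literature.MathematicalPhysics.QuantumFieldTheory.Dimock2011to13.UrsellTreeGraphBound (rhoT)

namespace Literature.MathematicalPhysics.QuantumFieldTheory.Dimock2011to13.TreeGraphSummationLattice

variable {d : ℕ}

/-- **(ninety) ON THE CARRIER, EXPONENTIATED**: for a non-empty finite set of unit cubes `X ⊂ ℤ^d`, `e^{|X|} ≤
e^{2^d}·e^{2^{d+2}ℓ̃(X)}` — from the cell's Lemma E.1 (3)-type bound `|X| ≤ 2^d(4ℓ̃(X) + 1)`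
(`TreeLength.card_le_steinerLen`), the analogue of Dimock's (ninety) *"|X|_M ≤ 3^d(1 + d_M(X))"*.
[cite: Dimock2013, eq. (ninety) (arXiv:1108.1335v2 TeX L1344–1348) and App. B Theorem cluster proof step 4 (L3467)] -/
theorem exp_card_le {X : Finset (Pt d)} (hX : X.Nonempty) :
    Real.exp (X.card : ℝ) ≤ Real.exp ((2 : ℝ) ^ d) * Real.exp (2 ^ (d + 2) * steinerLen X) := by
  rw [← Real.exp_add]
  refine Real.exp_le_exp.2 ?_
  calc (X.card : ℝ) ≤ 2 ^ d * (4 * steinerLen X + 1) := card_le_steinerLen hX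
    _ = 2 ^ d + 2 ^ (d + 2) * steinerLen X := by ring

/-- pointwise: `e^{−2κ₀ℓ̃(X)}·e^{|X|} ≤ e^{2^d}·e^{−(2κ₀ − 2^{d+2})ℓ̃(X)}` (*"Here we used again |Y_j|_M ≤ κ₀(1 + d_M(Y_j))"*,
L3467, on the carrier). [cite: Dimock2013, App. B Theorem cluster, proof step 4 (arXiv:1108.1335v2 TeX L3457–3468)] -/
theorem weight_mul_exp_card_le {X : Finset (Pt d)} (hX : X.Nonempty) (κ₀ : ℝ) :
    Real.exp (-2 * κ₀ * steinerLen X) * Real.exp (X.card : ℝ) ≤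
      Real.exp ((2 : ℝ) ^ d) * Real.exp (-((2 * κ₀ - 2 ^ (d + 2)) * steinerLen X)) := by
  calc Real.exp (-2 * κ₀ * steinerLen X) * Real.exp (X.card : ℝ)
      ≤ Real.exp (-2 * κ₀ * steinerLen X) * (Real.exp ((2 : ℝ) ^ d) * Real.exp (2 ^ (d + 2) * steinerLen X)) :=
        mul_le_mul_of_nonneg_left (exp_card_le hX) (Real.exp_nonneg _)
    _ = Real.exp ((2 : ℝ) ^ d) * Real.exp (-((2 * κ₀ - 2 ^ (d + 2)) * steinerLen X)) := by
        rw [mul_left_comm, ← Real.exp_add, ← Real.exp_add, ← Real.exp_add]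
        congr 1
        ring

/-- the cell's explicit stand-in for Dimock's constant `K₀e^{κ₀}` of the vertex estimate, on the `ℤ^d` carrier with the
Steiner length: `φ(d, κ₀) = e^{2^d}·2·exp((2κ₀ − 2^{d+2})(2^d − 1)/(2 + 2^{d+2}))` (the `e^{2^d}` of (ninety) times App. E's
constant of `kumquat_steiner` at `a = 2κ₀ − 2^{d+2}`). [cite: Dimock2013, App. B Theorem cluster, proof step 4 (arXiv:1108.1335v2 TeX L3457–3468)] -/
def phi (d : ℕ) (κ₀ : ℝ) : ℝ :=
  Real.exp ((2 : ℝ) ^ d) * (2 * Real.exp ((2 * κ₀ - 2 ^ (d + 2)) / (2 + 2 ^ (d + 2)) * (2 ^ d - 1)))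

/-- `φ(d, κ₀) ≥ 0`. [cite: Dimock2013, App. B Theorem cluster, proof step 4 (arXiv:1108.1335v2 TeX L3457–3468)] -/
theorem phi_nonneg (d : ℕ) (κ₀ : ℝ) : 0 ≤ phi d κ₀ := by
  unfold phi
  positivity

/-- **THE ANCHORED EXPONENTIAL NORM ON THE CARRIER** ((sudsy)'s input DISCHARGED by App. E): for a finite set `Q` of
non-empty cube polymers, weights `0 ≤ w(X) ≤ H·e^{−2κ₀ℓ̃(X)}` and `κ₀` above the threshold of `kumquat_steiner` at
`a = 2κ₀ − 2^{d+2}` (`3^d·e^{−a/(2+2^{d+2})} ≤ 1/8`): `Σ_{X ∈ Q: q ∈ X} w(X)·e^{|X|} ≤ H·φ(d, κ₀)` for every cube `q`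
— `weight_mul_exp_card_le` and `SteinerLengthSums.kumquat_steiner` (Lemma E.2 for the Steiner length).
[cite: Dimock2013, App. A Corollary cranberry with App. B Theorem cluster proof step 4 (arXiv:1108.1335v2 TeX L3140–3156, L3452–3468)] -/
theorem anchoredNorm_le {Q : Finset (Finset (Pt d))} (hQ : ∀ X ∈ Q, X.Nonempty) {κ₀ : ℝ}
    (hκ₀ : (3 : ℝ) ^ d * Real.exp (-((2 * κ₀ - 2 ^ (d + 2)) / (2 + 2 ^ (d + 2)))) ≤ 1 / 8)
    {w : Finset (Pt d) → ℝ} {H : ℝ} (hH : 0 ≤ H) (hw : ∀ X ∈ Q, w X ≤ H * Real.exp (-2 * κ₀ * steinerLen X))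
    (q : Pt d) :
    ∑ X ∈ Q with q ∈ X, w X * Real.exp (X.card : ℝ) ≤ H * phi d κ₀ := by
  have hk := kumquat_steiner hκ₀ q (Q.filter fun X => q ∈ X) fun X hX => (Finset.mem_filter.1 hX).2
  calc ∑ X ∈ Q with q ∈ X, w X * Real.exp (X.card : ℝ)
      ≤ ∑ X ∈ Q with q ∈ X, H * (Real.exp ((2 : ℝ) ^ d) *
          Real.exp (-((2 * κ₀ - 2 ^ (d + 2)) * steinerLen X))) := by
        refine Finset.sum_le_sum fun X hX => ?_
        have hXQ : X ∈ Q := (Finset.mem_filter.1 hX).1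
        calc w X * Real.exp (X.card : ℝ) ≤ H * Real.exp (-2 * κ₀ * steinerLen X) * Real.exp (X.card : ℝ) :=
              mul_le_mul_of_nonneg_right (hw X hXQ) (Real.exp_nonneg _)
          _ = H * (Real.exp (-2 * κ₀ * steinerLen X) * Real.exp (X.card : ℝ)) := mul_assoc _ _ _
          _ ≤ H * (Real.exp ((2 : ℝ) ^ d) * Real.exp (-((2 * κ₀ - 2 ^ (d + 2)) * steinerLen X))) :=
              mul_le_mul_of_nonneg_left (weight_mul_exp_card_le (hQ X hXQ) κ₀) hH
    _ = H * Real.exp ((2 : ℝ) ^ d) * ∑ X ∈ Q with q ∈ X, Real.exp (-((2 * κ₀ - 2 ^ (d + 2)) * steinerLen X)) := by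
        rw [Finset.mul_sum]
        exact Finset.sum_congr rfl fun X _ => by ring
    _ ≤ H * Real.exp ((2 : ℝ) ^ d) * (2 * Real.exp ((2 * κ₀ - 2 ^ (d + 2)) / (2 + 2 ^ (d + 2)) * (2 ^ d - 1))) :=
        mul_le_mul_of_nonneg_left hk (by positivity)
    _ = H * phi d κ₀ := by unfold phi; ring

/-- **STEP 4's `n`-TH TERM BOUND ON THE CARRIER, HYPOTHESES DISCHARGED**: for non-empty cube polymers `Q` all meeting
`Y`, weights `0 ≤ w ≤ H·e^{−2κ₀ℓ̃}` (`H ≥ 0`: the activity size, Dimock's `O(1)H₀`), `κ₀` above the explicit threshold: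
`Σ_{(Y_j)∈Q^n} |ρ^T(Y_1,…,Y_n)|·Π_j w(Y_j) ≤ (H·φ)^n·|Y|·(n−1)!·4^{n−1}` — `TreeGraphSummation.sum_abs_rhoT_mul_prod_le_of_anchored`
with `anchoredNorm_le`.  (Dimock's (spit1)+(spit2) carry `e^{−(κ₂−2κ₀−1)d_M(Y)}` in place of `|Y|`, by (clams) — not
reproduced.) [cite: Dimock2013, App. B Theorem cluster, proof step 4 eqs. (sundry)–(spit2) (arXiv:1108.1335v2 TeX L3405–3500)] -/
theorem sum_abs_rhoT_mul_prod_le {n : ℕ} [NeZero n] {Q : Finset (Finset (Pt d))} (hQ : ∀ X ∈ Q, X.Nonempty)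
    {Y : Finset (Pt d)} (hQY : ∀ X ∈ Q, ¬ Disjoint X Y) {κ₀ : ℝ}
    (hκ₀ : (3 : ℝ) ^ d * Real.exp (-((2 * κ₀ - 2 ^ (d + 2)) / (2 + 2 ^ (d + 2)))) ≤ 1 / 8)
    {w : Finset (Pt d) → ℝ} {H : ℝ} (hH : 0 ≤ H) (hw0 : ∀ X ∈ Q, 0 ≤ w X)
    (hw : ∀ X ∈ Q, w X ≤ H * Real.exp (-2 * κ₀ * steinerLen X)) :
    ∑ Z ∈ Fintype.piFinset (fun _ : Fin n => Q), |(rhoT Z univ : ℝ)| * ∏ j, w (Z j) ≤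
      (H * phi d κ₀) ^ n * (Y.card : ℝ) * ((n - 1).factorial * 4 ^ (n - 1) : ℕ) :=
  sum_abs_rhoT_mul_prod_le_of_anchored hw0 (mul_nonneg hH (phi_nonneg d κ₀)) (anchoredNorm_le hQ hκ₀ hH hw) hQY

/-- **"DIVIDE BY n! AND SUM OVER n" ON THE CARRIER** (L3504–3509): under the same hypotheses and `H·φ(d, κ₀) ≤ 1/8`
(Dimock: *"provided H₀ ≤ c₀ and c₀ is sufficiently small"*), every partial sum of `Σ_n (1/n!) Σ_{(Y_j)∈Q^n} |ρ^T|·Π_j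
w(Y_j)` is at most `2·Hφ·|Y|` — `TreeGraphSummation.hstar_partialSum_le` with the hypotheses from `anchoredNorm_le`.
[cite: Dimock2013, App. B Theorem cluster, proof step 4 (arXiv:1108.1335v2 TeX L3504–3511)] -/
theorem hstar_partialSum_le_lattice {Q : Finset (Finset (Pt d))} (hQ : ∀ X ∈ Q, X.Nonempty)
    {Y : Finset (Pt d)} (hQY : ∀ X ∈ Q, ¬ Disjoint X Y) {κ₀ : ℝ}
    (hκ₀ : (3 : ℝ) ^ d * Real.exp (-((2 * κ₀ - 2 ^ (d + 2)) / (2 + 2 ^ (d + 2)))) ≤ 1 / 8)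
    {w : Finset (Pt d) → ℝ} {H : ℝ} (hH : 0 ≤ H) (hw0 : ∀ X ∈ Q, 0 ≤ w X)
    (hw : ∀ X ∈ Q, w X ≤ H * Real.exp (-2 * κ₀ * steinerLen X)) (hsmall : H * phi d κ₀ ≤ 1 / 8) (N : ℕ) :
    ∑ n ∈ Finset.range N, (1 / ((n + 1).factorial : ℝ)) *
        ∑ Z ∈ Fintype.piFinset (fun _ : Fin (n + 1) => Q), |(rhoT Z univ : ℝ)| * ∏ j, w (Z j) ≤
      2 * (H * phi d κ₀) * (Y.card : ℝ) :=
  hstar_partialSum_le hw0 (fun _ _ => Nat.cast_nonneg _) (mul_nonneg hH (phi_nonneg d κ₀)) (Nat.cast_nonneg _)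
    hsmall (vertexHyp_of_anchored hw0 (anchoredNorm_le hQ hκ₀ hH hw))
    (rootHyp_of_anchored hw0 (anchoredNorm_le hQ hκ₀ hH hw) hQY) N

/-! ## §2 (v1.1) (clams) along a tree graph, the DECAY EXTRACTION (L3430–3438) and the decayed `n`-th term -/

section Decay

open Literature.Combinatorics.Enumerative (IsForestOn)
open Literature.MathematicalPhysics.QuantumFieldTheory.Dimock2011to13.SteinerLengthUnionBound
  (steinerLen_biUnion_range_le)
open Literature.MathematicalPhysics.QuantumFieldTheory.Dimock2011to13.TreeGraphSummation (exists_relabel)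
open Literature.MathematicalPhysics.QuantumFieldTheory.Dimock2011to13.UrsellTreeGraphBound
  (treeGraphs mem_treeGraphs overlapGraph abs_rhoT_le_card_treeGraphs)

/-- **(clams) ALONG A TREE GRAPH** (L3250–3252: *"consider the connected graph whose edges are pairs {X_i, X_j} such
that X_i ∩ X_j ≠ ∅. Take a tree which is a subgraph with (n−1) edges"*): for cube polymers `Z_u`, `u ∈ Fin n`,
compatible with a tree graph `t` rooted at `0` (`Z_u ∩ Z_{t(u)} ≠ ∅` for `u ≠ 0`), `ℓ̃(⋃_u Z_u) ≤ Σ_u ℓ̃(Z_u) + (n −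
1)` — the ordered (clams) of `SteinerLengthUnionBound` after relabelling the tree (`TreeGraphSummation.exists_relabel`).
[cite: Dimock2013, App. B Theorem cluster, proof step 1 eq. (clams) (arXiv:1108.1335v2 TeX L3246–3256)] -/
theorem steinerLen_biUnion_le_of_tree {n : ℕ} [NeZero n] {t : Fin n → Fin n}
    (ht : IsForestOn (univ : Finset (Fin n)) {0} t) (Z : Fin n → Finset (Pt d))
    (hcompat : ∀ u : Fin n, u ≠ 0 → ¬ Disjoint (Z u) (Z (t u))) :
    steinerLen (univ.biUnion Z) ≤ ∑ j, steinerLen (Z j) + ((n : ℝ) - 1) := by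
  obtain ⟨n, rfl⟩ : ∃ n', n = n' + 1 := ⟨n - 1, (Nat.succ_pred_eq_of_ne_zero (NeZero.ne n)).symm⟩
  obtain ⟨σ, hσ0, hσ⟩ := exists_relabel ht
  let Z' : ℕ → Finset (Pt d) := fun k => if h : k < n + 1 then Z (σ ⟨k, h⟩) else ∅
  have hZ'k : ∀ (k : ℕ) (hk : k < n + 1), Z' k = Z (σ ⟨k, hk⟩) := fun k hk => dif_pos hk
  have hlink : ∀ j, 0 < j → j < n + 1 → ∃ i < j, ¬ Disjoint (Z' j) (Z' i) := by
    intro j hj hjn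
    have hne : (⟨j, hjn⟩ : Fin (n + 1)) ≠ 0 := by
      intro h0
      rw [Fin.ext_iff, Fin.val_zero] at h0
      exact hj.ne' h0
    have hσne : σ ⟨j, hjn⟩ ≠ 0 := fun h => hne (σ.injective (h.trans hσ0.symm))
    refine ⟨(σ.symm (t (σ ⟨j, hjn⟩)) : ℕ), ?_, ?_⟩
    · have := hσ ⟨j, hjn⟩ hne
      rwa [Fin.lt_def] at this
    · rw [hZ'k j hjn, hZ'k _ (σ.symm (t (σ ⟨j, hjn⟩))).isLt, Fin.eta, Equiv.apply_symm_apply]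
      exact hcompat _ hσne
  have hmain := steinerLen_biUnion_range_le Z' n hlink
  have hU : (Finset.range (n + 1)).biUnion Z' = univ.biUnion Z := by
    ext p
    simp only [Finset.mem_biUnion, Finset.mem_range, Finset.mem_univ, true_and]
    constructor
    · rintro ⟨k, hk, hp⟩
      exact ⟨σ ⟨k, hk⟩, by rwa [hZ'k k hk] at hp⟩
    · rintro ⟨u, hp⟩
      refine ⟨(σ.symm u : ℕ), (σ.symm u).isLt, ?_⟩
      rw [hZ'k _ (σ.symm u).isLt, Fin.eta, Equiv.apply_symm_apply]
      exact hp
  have hS : ∑ j ∈ Finset.range (n + 1), steinerLen (Z' j) = ∑ j, steinerLen (Z j) := by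
    rw [← Fin.sum_univ_eq_sum_range (fun k => steinerLen (Z' k)) (n + 1),
      ← Equiv.sum_comp σ (fun u => steinerLen (Z u))]
    exact Fintype.sum_congr _ _ fun j => by rw [hZ'k _ j.isLt, Fin.eta]
  rw [hU, hS] at hmain
  have hcast : ((n + 1 : ℕ) : ℝ) - 1 = n := by push_cast; ring
  rw [hcast]
  exact hmain

/-- **THE DECAY EXTRACTION** (L3435–3438: *"Next use the inequality (clams) to bound this by e^{−(κ₂−2κ₀)d_M(Y)}(O(1)H₀)^n
Σ_τ Σ Π_i e^{−2κ₀d_M(Y_i)}"*): along a tree graph, `Π_u e^{−κ′ℓ̃(Z_u)} ≤ e^{κ′(n−1)}·e^{−κ′ℓ̃(⋃_u Z_u)}` for `κ′ ≥ 0`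
(the factor `e^{κ′(n−1)}` is the price of (clams)'s `+M(n−1)`, absorbed by Dimock in `(O(1)H₀)^n`: *"(So c₀ does
depend on κ.)"*, L3271). [cite: Dimock2013, App. B Theorem cluster, proof step 4 (arXiv:1108.1335v2 TeX L3430–3438)] -/
theorem prod_exp_neg_le_of_tree {n : ℕ} [NeZero n] {t : Fin n → Fin n}
    (ht : IsForestOn (univ : Finset (Fin n)) {0} t) (Z : Fin n → Finset (Pt d))
    (hcompat : ∀ u : Fin n, u ≠ 0 → ¬ Disjoint (Z u) (Z (t u))) {κ' : ℝ} (hκ' : 0 ≤ κ') :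
    ∏ j, Real.exp (-(κ' * steinerLen (Z j))) ≤
      Real.exp (κ' * ((n : ℝ) - 1)) * Real.exp (-(κ' * steinerLen (univ.biUnion Z))) := by
  rw [← Real.exp_sum, ← Real.exp_add]
  refine Real.exp_le_exp.2 ?_
  have h := mul_le_mul_of_nonneg_left (steinerLen_biUnion_le_of_tree ht Z hcompat) hκ'
  rw [Finset.sum_neg_distrib, ← Finset.mul_sum]
  linarith

/-- a tuple with `ρ^T ≠ 0` is compatible with some tree graph rooted at `0` (*"|ρ^T(Y_1,…,Y_n)| ≤ number of tree
graphs contained in g"*, `UrsellTreeGraphBound.abs_rhoT_le_card_treeGraphs`). [cite: Dimock2013, App. B Theorem cluster, proof step 4 (arXiv:1108.1335v2 TeX L3405–3421)] -/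
theorem exists_tree_of_rhoT_ne_zero {n : ℕ} [NeZero n] (Z : Fin n → Finset (Pt d)) (h : rhoT Z univ ≠ 0) :
    ∃ t : Fin n → Fin n, IsForestOn (univ : Finset (Fin n)) {0} t ∧
      ∀ u : Fin n, u ≠ 0 → ¬ Disjoint (Z u) (Z (t u)) := by
  have hle := abs_rhoT_le_card_treeGraphs Z (I := univ) (Finset.mem_univ (0 : Fin n))
  have hpos : 0 < (treeGraphs (overlapGraph Z) univ 0).card := by
    by_contra h0
    have hz : (treeGraphs (overlapGraph Z) univ 0).card = 0 := by omega
    rw [hz, Nat.cast_zero] at hle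
    exact h (abs_nonpos_iff.1 hle)
  obtain ⟨t, ht⟩ := Finset.card_pos.1 hpos
  rw [mem_treeGraphs] at ht
  exact ⟨t, ht.1, fun u hu => ht.2 u (Finset.mem_erase.2 ⟨hu, Finset.mem_univ u⟩)⟩

/-- **STEP 4's `n`-TH TERM WITH THE DECAY IN `Y`** ((owl)+(clams)+(sundry)→(spit1) on the carrier): for non-empty cube
polymers `Q` meeting `Y`, weights `0 ≤ w(X) ≤ H·e^{−κℓ̃(X)}` with `κ ≥ 2κ₀` (Dimock: `κ₂ = κ − κ₀ − 1` in the role of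
`κ`), `κ₀` above the threshold of `anchoredNorm_le`: the sum over the `n`-tuples from `Q` WHOSE UNION IS `Y` of
`|ρ^T(Z)|·Π_j w(Z_j)` is at most `e^{(κ−2κ₀)(n−1)}·e^{−(κ−2κ₀)ℓ̃(Y)}·(Hφ)^n·#Y·(n−1)!·4^{n−1}` — termwise: a tuple with
`ρ^T ≠ 0` carries a tree graph (`exists_tree_of_rhoT_ne_zero`), along which (clams) extracts `e^{−(κ−2κ₀)ℓ̃(Y)}`
(`prod_exp_neg_le_of_tree`); then the constraint `⋃Z = Y` is dropped and `sum_abs_rhoT_mul_prod_le` (v1) bounds the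
rest. [cite: Dimock2013, App. B Theorem cluster, proof step 4 (arXiv:1108.1335v2 TeX L3416–3484)] -/
theorem sum_abs_rhoT_mul_prod_le_decay {n : ℕ} [NeZero n] {Q : Finset (Finset (Pt d))}
    (hQ : ∀ X ∈ Q, X.Nonempty) {Y : Finset (Pt d)} (hQY : ∀ X ∈ Q, ¬ Disjoint X Y) {κ₀ κ : ℝ}
    (hκ₀ : (3 : ℝ) ^ d * Real.exp (-((2 * κ₀ - 2 ^ (d + 2)) / (2 + 2 ^ (d + 2)))) ≤ 1 / 8) (hκ : 2 * κ₀ ≤ κ)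
    {w : Finset (Pt d) → ℝ} {H : ℝ} (hH : 0 ≤ H) (hw0 : ∀ X ∈ Q, 0 ≤ w X)
    (hw : ∀ X ∈ Q, w X ≤ H * Real.exp (-κ * steinerLen X)) :
    ∑ Z ∈ (Fintype.piFinset fun _ : Fin n => Q) with Finset.univ.biUnion Z = Y,
        |(rhoT Z univ : ℝ)| * ∏ j, w (Z j) ≤
      Real.exp ((κ - 2 * κ₀) * ((n : ℝ) - 1)) * Real.exp (-((κ - 2 * κ₀) * steinerLen Y)) *
        ((H * phi d κ₀) ^ n * (Y.card : ℝ) * ((n - 1).factorial * 4 ^ (n - 1) : ℕ)) := by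
  set C := Real.exp ((κ - 2 * κ₀) * ((n : ℝ) - 1)) * Real.exp (-((κ - 2 * κ₀) * steinerLen Y)) with hC
  set w' : Finset (Pt d) → ℝ := fun X => H * Real.exp (-2 * κ₀ * steinerLen X) with hw'
  have hw'nn : ∀ X, 0 ≤ w' X := fun X => by simp only [hw']; positivity
  have hCnn : 0 ≤ C := by positivity
  have hterm : ∀ Z ∈ (Fintype.piFinset fun _ : Fin n => Q).filter (fun Z => Finset.univ.biUnion Z = Y),
      |(rhoT Z univ : ℝ)| * ∏ j, w (Z j) ≤ C * (|(rhoT Z univ : ℝ)| * ∏ j, w' (Z j)) := by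
    intro Z hZ
    obtain ⟨hZQ, hZY⟩ := Finset.mem_filter.1 hZ
    have hZQ' : ∀ j, Z j ∈ Q := fun j => Fintype.mem_piFinset.1 hZQ j
    by_cases hρ : rhoT Z univ = 0
    · simp [hρ]
    · obtain ⟨t, ht, hcompat⟩ := exists_tree_of_rhoT_ne_zero Z hρ
      have hprodw : ∏ j, w (Z j) ≤ ∏ j, (H * Real.exp (-κ * steinerLen (Z j))) :=
        Finset.prod_le_prod (fun j _ => hw0 _ (hZQ' j)) fun j _ => hw _ (hZQ' j)
      have hsplit : ∏ j, (H * Real.exp (-κ * steinerLen (Z j))) =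
          (∏ j, Real.exp (-((κ - 2 * κ₀) * steinerLen (Z j)))) * ∏ j, w' (Z j) := by
        rw [← Finset.prod_mul_distrib]
        refine Fintype.prod_congr _ _ fun j => ?_
        simp only [hw']
        rw [mul_left_comm, ← Real.exp_add]
        congr 2
        ring
      have hdec := prod_exp_neg_le_of_tree ht Z hcompat (κ' := κ - 2 * κ₀) (by linarith)
      rw [hZY] at hdec
      have hPnn : 0 ≤ ∏ j, w' (Z j) := Finset.prod_nonneg fun j _ => hw'nn _
      calc |(rhoT Z univ : ℝ)| * ∏ j, w (Z j)
          ≤ |(rhoT Z univ : ℝ)| * ((∏ j, Real.exp (-((κ - 2 * κ₀) * steinerLen (Z j)))) * ∏ j, w' (Z j)) := by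
            rw [← hsplit]
            exact mul_le_mul_of_nonneg_left hprodw (abs_nonneg _)
        _ ≤ |(rhoT Z univ : ℝ)| * (C * ∏ j, w' (Z j)) :=
            mul_le_mul_of_nonneg_left (mul_le_mul_of_nonneg_right hdec hPnn) (abs_nonneg _)
        _ = C * (|(rhoT Z univ : ℝ)| * ∏ j, w' (Z j)) := by ring
  calc ∑ Z ∈ (Fintype.piFinset fun _ : Fin n => Q) with Finset.univ.biUnion Z = Y,
          |(rhoT Z univ : ℝ)| * ∏ j, w (Z j)
      ≤ ∑ Z ∈ (Fintype.piFinset fun _ : Fin n => Q) with Finset.univ.biUnion Z = Y,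
          C * (|(rhoT Z univ : ℝ)| * ∏ j, w' (Z j)) := Finset.sum_le_sum hterm
    _ ≤ ∑ Z ∈ Fintype.piFinset (fun _ : Fin n => Q), C * (|(rhoT Z univ : ℝ)| * ∏ j, w' (Z j)) :=
        Finset.sum_le_sum_of_subset_of_nonneg (Finset.filter_subset _ _) fun Z _ _ =>
          mul_nonneg hCnn (mul_nonneg (abs_nonneg _) (Finset.prod_nonneg fun j _ => hw'nn _))
    _ = C * ∑ Z ∈ Fintype.piFinset (fun _ : Fin n => Q), |(rhoT Z univ : ℝ)| * ∏ j, w' (Z j) := by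
        rw [Finset.mul_sum]
    _ ≤ C * ((H * phi d κ₀) ^ n * (Y.card : ℝ) * ((n - 1).factorial * 4 ^ (n - 1) : ℕ)) :=
        mul_le_mul_of_nonneg_left
          (sum_abs_rhoT_mul_prod_le hQ hQY hκ₀ hH (fun X _ => hw'nn X) fun X _ => le_rfl) hCnn

/-- the root's volume factor folded into the decay (L3476–3477: *"≤ (d_1−1)! K₀e^{κ₀}|Y|_M ≤ (d_1−1)! K₀κ₀e^{κ₀}e^{d_M(Y)}"*,
from *"|Y|_M ≤ κ₀(1 + d_M(Y))"*), on the carrier: `#Y ≤ 2^{d+2}·e^{ℓ̃(Y)}` for `Y ≠ ∅` (`card_le_steinerLen`, `1 + x ≤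
e^x`). [cite: Dimock2013, App. B Theorem cluster, proof step 4 (arXiv:1108.1335v2 TeX L3470–3478)] -/
theorem card_le_exp_steinerLen {Y : Finset (Pt d)} (hY : Y.Nonempty) :
    (Y.card : ℝ) ≤ 2 ^ (d + 2) * Real.exp (steinerLen Y) := by
  calc (Y.card : ℝ) ≤ 2 ^ d * (4 * steinerLen Y + 1) := card_le_steinerLen hY
    _ ≤ 2 ^ (d + 2) * (steinerLen Y + 1) := by
        rw [pow_add]
        nlinarith [steinerLen_nonneg Y, pow_nonneg (by norm_num : (0 : ℝ) ≤ 2) d]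
    _ ≤ 2 ^ (d + 2) * Real.exp (steinerLen Y) :=
        mul_le_mul_of_nonneg_left (by linarith [Real.add_one_le_exp (steinerLen Y)]) (by positivity)

/-- **"DIVIDE BY n! AND SUM OVER n", WITH THE DECAY** (L3504–3511: *"|H^#(Y)| ≤ e^{−(κ₂−2κ₀−1)d_M(Y)} Σ_{n=1}^∞ (O(1)H₀)^n
≤ O(1)H₀ e^{−(κ₂−2κ₀−1)d_M(Y)} provided H₀ ≤ c₀ and c₀ is sufficiently small."*, with L3271 *"(So c₀ does depend on
κ.)"*), on the carrier: under the hypotheses of `sum_abs_rhoT_mul_prod_le_decay` and the smallness `4·Hφ·e^{κ−2κ₀} ≤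
1/2`, every partial sum of `Σ_n (1/n!) Σ_{Z∈Q^n, ⋃Z=Y} |ρ^T(Z)|·Π_j w(Z_j)` is at most `2·Hφ·#Y·e^{−(κ−2κ₀)ℓ̃(Y)}`
(hence, by `card_le_exp_steinerLen`, `≤ 2^{d+3}·Hφ·e^{−(κ−2κ₀−1)ℓ̃(Y)}` — the printed exponent `κ₂ − 2κ₀ − 1`).
[cite: Dimock2013, App. B Theorem cluster, proof step 4 (arXiv:1108.1335v2 TeX L3501–3511)] -/
theorem hstar_partialSum_le_decay {Q : Finset (Finset (Pt d))} (hQ : ∀ X ∈ Q, X.Nonempty) {Y : Finset (Pt d)}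
    (hQY : ∀ X ∈ Q, ¬ Disjoint X Y) {κ₀ κ : ℝ}
    (hκ₀ : (3 : ℝ) ^ d * Real.exp (-((2 * κ₀ - 2 ^ (d + 2)) / (2 + 2 ^ (d + 2)))) ≤ 1 / 8) (hκ : 2 * κ₀ ≤ κ)
    {w : Finset (Pt d) → ℝ} {H : ℝ} (hH : 0 ≤ H) (hw0 : ∀ X ∈ Q, 0 ≤ w X)
    (hw : ∀ X ∈ Q, w X ≤ H * Real.exp (-κ * steinerLen X))
    (hsmall : 4 * (H * phi d κ₀) * Real.exp (κ - 2 * κ₀) ≤ 1 / 2) (N : ℕ) :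
    ∑ n ∈ Finset.range N, (1 / ((n + 1).factorial : ℝ)) *
        ∑ Z ∈ (Fintype.piFinset fun _ : Fin (n + 1) => Q) with Finset.univ.biUnion Z = Y,
          |(rhoT Z univ : ℝ)| * ∏ j, w (Z j) ≤
      2 * (H * phi d κ₀) * (Y.card : ℝ) * Real.exp (-((κ - 2 * κ₀) * steinerLen Y)) := by
  set A := H * phi d κ₀ with hA
  set E := Real.exp (-((κ - 2 * κ₀) * steinerLen Y)) with hE
  have hAnn : 0 ≤ A := mul_nonneg hH (phi_nonneg d κ₀)
  have hr0 : 0 ≤ 4 * A * Real.exp (κ - 2 * κ₀) := by positivity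
  have hterm : ∀ n : ℕ, (1 / ((n + 1).factorial : ℝ)) *
      ∑ Z ∈ (Fintype.piFinset fun _ : Fin (n + 1) => Q) with Finset.univ.biUnion Z = Y,
        |(rhoT Z univ : ℝ)| * ∏ j, w (Z j) ≤ A * (Y.card : ℝ) * E * (4 * A * Real.exp (κ - 2 * κ₀)) ^ n := by
    intro n
    have h := sum_abs_rhoT_mul_prod_le_decay (n := n + 1) hQ hQY hκ₀ hκ hH hw0 hw
    simp only [Nat.cast_add, Nat.cast_one, add_sub_cancel_right, Nat.add_sub_cancel] at h
    have hexp : Real.exp ((κ - 2 * κ₀) * (n : ℝ)) = Real.exp (κ - 2 * κ₀) ^ n := by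
      rw [← Real.exp_nat_mul, mul_comm]
    rw [hexp] at h
    calc (1 / ((n + 1).factorial : ℝ)) *
          ∑ Z ∈ (Fintype.piFinset fun _ : Fin (n + 1) => Q) with Finset.univ.biUnion Z = Y,
            |(rhoT Z univ : ℝ)| * ∏ j, w (Z j)
        ≤ (1 / ((n + 1).factorial : ℝ)) * (Real.exp (κ - 2 * κ₀) ^ n * E *
            (A ^ (n + 1) * (Y.card : ℝ) * ((n.factorial * 4 ^ n : ℕ) : ℝ))) :=
          mul_le_mul_of_nonneg_left h (by positivity)
      _ = ((n.factorial : ℝ) / (n + 1).factorial) * (A * (Y.card : ℝ) * E * (4 * A * Real.exp (κ - 2 * κ₀)) ^ n) := by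
          push_cast
          ring
      _ ≤ 1 * (A * (Y.card : ℝ) * E * (4 * A * Real.exp (κ - 2 * κ₀)) ^ n) :=
          mul_le_mul_of_nonneg_right
            (div_le_one_of_le₀ (by exact_mod_cast Nat.factorial_le (Nat.le_succ n)) (by positivity))
            (by positivity)
      _ = A * (Y.card : ℝ) * E * (4 * A * Real.exp (κ - 2 * κ₀)) ^ n := one_mul _
  have hgeom : ∑ n ∈ Finset.range N, (4 * A * Real.exp (κ - 2 * κ₀)) ^ n ≤ 2 := by
    calc ∑ n ∈ Finset.range N, (4 * A * Real.exp (κ - 2 * κ₀)) ^ n ≤ ∑ n ∈ Finset.range N, (1 / 2 : ℝ) ^ n :=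
          Finset.sum_le_sum fun n _ => pow_le_pow_left₀ hr0 hsmall n
      _ = 2 - 2 * (1 / 2 : ℝ) ^ N := by
          rw [geom_sum_eq (by norm_num) N]
          ring
      _ ≤ 2 := by linarith [pow_nonneg (by norm_num : (0 : ℝ) ≤ 1 / 2) N]
  calc ∑ n ∈ Finset.range N, (1 / ((n + 1).factorial : ℝ)) *
          ∑ Z ∈ (Fintype.piFinset fun _ : Fin (n + 1) => Q) with Finset.univ.biUnion Z = Y,
            |(rhoT Z univ : ℝ)| * ∏ j, w (Z j)
      ≤ ∑ n ∈ Finset.range N, A * (Y.card : ℝ) * E * (4 * A * Real.exp (κ - 2 * κ₀)) ^ n :=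
        Finset.sum_le_sum fun n _ => hterm n
    _ = A * (Y.card : ℝ) * E * ∑ n ∈ Finset.range N, (4 * A * Real.exp (κ - 2 * κ₀)) ^ n := by
        rw [Finset.mul_sum]
    _ ≤ A * (Y.card : ℝ) * E * 2 := mul_le_mul_of_nonneg_left hgeom (by positivity)
    _ = 2 * A * (Y.card : ℝ) * E := by ring

end Decay

end Literature.MathematicalPhysics.QuantumFieldTheory.Dimock2011to13.TreeGraphSummationLattice
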